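import Mathlib
import Summits.KontsevichZagierPeriods.Zeta5Search.RecordCellATwoPoint
import HarnessLib

/-!
# ζ(5) search — partial-fraction coefficients at a TWO-POINT residue class `{q₀, q₀ + p}` (part 2)

Cell `pub-zeta5` (HONEST FRAMING: systematic search; no irrationality claim unless certified), P1 prover seat
generation 5; continues `RecordCellATwoPoint.lean`.  For `b` in the polytope, a window prime `p` (`p² > b₀ + 2`) and a
class `{q₀, q₀ + p}` with `q₀ < p ≤ q₀ + p ≤ b₀ < q₀ + 2p` (two points, levels 0 and 1) every other position is foreign
(`far_of_twoPoint`), so the constant terms `gTop` / `gBot` of `Gout` based at the upper / lower point are `p`-integral and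
congruent modulo `p`; and the canonical partial-fraction coefficients `pfData b o q` at the two points are EXACT rational
expressions in the integral coefficients of `Gout` for the two class types of the record cell:
orders `(1,3)` (`netExp = (−1,−3)`: `pfA_top`, `pfA_bot`) and `(2,2)` (`netExp = (−2,−2)`: `pfS_top`, `pfS_bot`).
Identities of rational numbers; nothing about irrationality.
-/

noncomputable section

open Finset PowerSeries

namespace Summit.KontsevichZagierPeriods.Zeta5Search.CellA

open Summit.KontsevichZagierPeriods.Zeta5Search.DualSeries (InBox)
open Summit.KontsevichZagierPeriods.Zeta5Search.WedgeDictionary (IsPFData pfData)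
open Summit.KontsevichZagierPeriods.Zeta5Search.CasoratianValuation (InPolytope)
open Summit.KontsevichZagierPeriods.Zeta5Search.ClusterValuation
open Summit.KontsevichZagierPeriods.Zeta5Search.PadicSeries

variable {p : ℕ} [hp : Fact p.Prime]

/-! ### Two-point classes `{q₀, q₀ + p}` with `q₀ < p ≤ q₀ + p ≤ b₀ < q₀ + 2p` -/

omit hp in
/-- In a two-point class every other position is foreign (base `q₀`). -/
theorem far_of_twoPoint {b : ℕ → ℤ} {q₀ : ℕ} (hp0 : 0 < p) (hq₀ : q₀ < p) (htop : (b 0).toNat < q₀ + 2 * p) :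
    ∀ s, s ≤ (b 0).toNat → s ≠ q₀ → s ≠ q₀ + p → ¬ (p : ℤ) ∣ (s : ℤ) - q₀ := by
  intro s hs h0 h1 hdvd
  obtain ⟨k, hk⟩ := hdvd
  have hk0 : 0 ≤ k := by
    by_contra hneg
    push Not at hneg
    have : (p : ℤ) * k ≤ (p : ℤ) * (-1) := mul_le_mul_of_nonneg_left (by omega) (by omega)
    omega
  have hk2 : k < 2 := by
    by_contra hge
    push Not at hge
    have : (p : ℤ) * 2 ≤ (p : ℤ) * k := mul_le_mul_of_nonneg_left hge (by omega)
    omega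
  interval_cases k <;> omega

omit hp in
/-- In a two-point class every other position is foreign (base `q₀ + p`). -/
theorem far_of_twoPoint' {b : ℕ → ℤ} {q₀ : ℕ} (hp0 : 0 < p) (hq₀ : q₀ < p) (htop : (b 0).toNat < q₀ + 2 * p) :
    ∀ s, s ≤ (b 0).toNat → s ≠ q₀ + p → s ≠ q₀ → ¬ (p : ℤ) ∣ (s : ℤ) - ((q₀ + p : ℕ) : ℤ) := by
  intro s hs h1 h0 hdvd
  apply far_of_twoPoint hp0 hq₀ htop s hs h0 h1
  have : (s : ℤ) - q₀ = ((s : ℤ) - ((q₀ + p : ℕ) : ℤ)) + p := by push_cast; ring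
  rw [this]; exact hdvd.add (dvd_refl _)

/-- The constant term of `Gout` based at the UPPER point `q₀ + p` of the class `{q₀, q₀+p}`. -/
def gTop (b : ℕ → ℤ) (p q₀ : ℕ) (k : ℕ) : ℚ := coeff k (Gout b (q₀ + p) q₀)

/-- The constant term of `Gout` based at the LOWER point `q₀`. -/
def gBot (b : ℕ → ℤ) (p q₀ : ℕ) (k : ℕ) : ℚ := coeff k (Gout b q₀ (q₀ + p))

/-- The coefficients `gTop` are `p`-integral. -/
theorem padicNorm_gTop_le (b : ℕ → ℤ) {q₀ : ℕ} (hq₀ : q₀ < p) (hq₁ : q₀ + p ≤ (b 0).toNat)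
    (htop : (b 0).toNat < q₀ + 2 * p) (hn : (b 0).toNat < p ^ 2) (hp2 : p ≠ 2) (k : ℕ) :
    padicNorm p (gTop b p q₀ k) ≤ 1 :=
  padicNorm_coeff_gout_le b hq₁ hn hp2 (far_of_twoPoint' hp.out.pos hq₀ htop) k

/-- The coefficients `gBot` are `p`-integral. -/
theorem padicNorm_gBot_le (b : ℕ → ℤ) {q₀ : ℕ} (hq₀ : q₀ < p) (hq₁ : q₀ + p ≤ (b 0).toNat)
    (htop : (b 0).toNat < q₀ + 2 * p) (hn : (b 0).toNat < p ^ 2) (hp2 : p ≠ 2) (k : ℕ) :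
    padicNorm p (gBot b p q₀ k) ≤ 1 :=
  padicNorm_coeff_gout_le b (by omega) hn hp2 (far_of_twoPoint hp.out.pos hq₀ htop) k

/-- **`gTop 0 ≡ gBot 0 (mod p)`.** -/
theorem padicNorm_gTop_sub_gBot_le (b : ℕ → ℤ) {q₀ : ℕ} (hq₀ : q₀ < p) (hq₁ : q₀ + p ≤ (b 0).toNat)
    (htop : (b 0).toNat < q₀ + 2 * p) (hn : (b 0).toNat < p ^ 2) :
    padicNorm p (gTop b p q₀ 0 - gBot b p q₀ 0) ≤ (p : ℚ) ^ (-(1 : ℤ)) :=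
  padicNorm_goutConst_sub_le b hq₁ hn (far_of_twoPoint hp.out.pos hq₀ htop)

/-! ### The partial-fraction coefficients at a two-point class, type `(1,3)` and type `(2,2)` -/

section PF

variable (b : ℕ → ℤ) (hb : InPolytope b) (hwin : (b 0 + 2 : ℤ) < (p : ℤ) ^ 2) {q₀ : ℕ}
  (hq₁ : q₀ + p ≤ (b 0).toNat)

include hb hwin hq₁

omit hp hq₁ in
/-- `c_{o,q} = [X^{5−o}](X^{mult q}·Gser b q)` for the canonical data (`pf_eq_coeff_Gser` through `thmA_data`). -/
theorem pfData_eq_coeff {q : ℕ} (hq : q ≤ (b 0).toNat) {o : ℕ} (ho : o < 6) :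
    pfData b o q = coeff (5 - o) (X ^ mult b q * Gser b q) := by
  obtain ⟨hbox, hhalf, hpf, -⟩ := thmA_data b hb hwin
  exact pf_eq_coeff_Gser b hbox hhalf hpf hq ho

/-- **Type `(1,3)`, upper point**: with `netExp q₀ = −1`, `netExp (q₀+p) = −3`:
`c_{2,q₀+p} = −gTop₀/p`, `c_{1,q₀+p} = −gTop₁/p − gTop₀/p²`, `c_{0,q₀+p} = −gTop₂/p − gTop₁/p² − gTop₀/p³`,
and `c_{o,q₀+p} = 0` for `3 ≤ o < 6`. -/
theorem pfA_top (he₀ : netExp b q₀ = -1) (he₁ : netExp b (q₀ + p) = -3) :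
    pfData b 2 (q₀ + p) = -gTop b p q₀ 0 / p ∧
    pfData b 1 (q₀ + p) = -gTop b p q₀ 1 / p - gTop b p q₀ 0 / p ^ 2 ∧
    pfData b 0 (q₀ + p) = -gTop b p q₀ 2 / p - gTop b p q₀ 1 / p ^ 2 - gTop b p q₀ 0 / p ^ 3 ∧
    (∀ o, 3 ≤ o → o < 6 → pfData b o (q₀ + p) = 0) := by
  have hm₀ : mult b q₀ = 5 := by have := mult_eq_netExp b q₀; omega
  have hm₁ : mult b (q₀ + p) = 3 := by have := mult_eq_netExp b (q₀ + p); omega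
  have hp0 : (p : ℚ) ≠ 0 := Nat.cast_ne_zero.2 hp.out.ne_zero
  have hδ : ((q₀ : ℚ) - ((q₀ + p : ℕ) : ℚ)) = -(p : ℚ) := by push_cast; ring
  have hp0' : 0 < p := hp.out.pos
  have hF : Gser b (q₀ + p) * linS (-(p : ℚ)) ^ 1 = Gout b (q₀ + p) q₀ := by
    rw [← hδ]; exact gser_mul_linS_pow b (by omega) (by omega) (by rw [hm₀])
  rw [pow_one] at hF
  obtain ⟨c0, c1, c2⟩ := coeff_of_mul_linS (neg_ne_zero.2 hp0) hF
  have hc : ∀ {o : ℕ}, o < 6 → pfData b o (q₀ + p) = coeff (5 - o) (X ^ 3 * Gser b (q₀ + p)) := by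
    intro o ho; rw [pfData_eq_coeff b hb hwin hq₁ ho, hm₁]
  refine ⟨?_, ?_, ?_, ?_⟩
  · rw [hc (by norm_num), coeff_X_pow_mul', if_pos (by norm_num), show 5 - 2 - 3 = 0 from rfl, c0]
    unfold gTop; field_simp
  · rw [hc (by norm_num), coeff_X_pow_mul', if_pos (by norm_num), show 5 - 1 - 3 = 1 from rfl, c1, c0]
    unfold gTop; field_simp; ring
  · rw [hc (by norm_num), coeff_X_pow_mul', if_pos (by norm_num), show 5 - 0 - 3 = 2 from rfl, c2, c1, c0]
    unfold gTop; field_simp; ring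
  · intro o h3 h6
    rw [hc h6, coeff_X_pow_mul', if_neg (by omega)]

/-- **Type `(1,3)`, lower point**: `c_{0,q₀} = gBot₀/p³` and `c_{o,q₀} = 0` for `1 ≤ o < 6`. -/
theorem pfA_bot (he₀ : netExp b q₀ = -1) (he₁ : netExp b (q₀ + p) = -3) :
    pfData b 0 q₀ = gBot b p q₀ 0 / p ^ 3 ∧ (∀ o, 1 ≤ o → o < 6 → pfData b o q₀ = 0) := by
  have hm₀ : mult b q₀ = 5 := by have := mult_eq_netExp b q₀; omega
  have hm₁ : mult b (q₀ + p) = 3 := by have := mult_eq_netExp b (q₀ + p); omega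
  have hp0 : (p : ℚ) ≠ 0 := Nat.cast_ne_zero.2 hp.out.ne_zero
  have hδ : (((q₀ + p : ℕ) : ℚ) - q₀) = (p : ℚ) := by push_cast; ring
  have hp0' : 0 < p := hp.out.pos
  have hF : Gser b q₀ * linS (p : ℚ) ^ 3 = Gout b q₀ (q₀ + p) := by
    rw [← hδ]; exact gser_mul_linS_pow b hq₁ (by omega) (by rw [hm₁])
  have c0 := coeff_of_mul_linS_cube hp0 hF
  have hc : ∀ {o : ℕ}, o < 6 → pfData b o q₀ = coeff (5 - o) (X ^ 5 * Gser b q₀) := by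
    intro o ho; rw [pfData_eq_coeff b hb hwin (by omega) ho, hm₀]
  refine ⟨?_, ?_⟩
  · rw [hc (by norm_num), coeff_X_pow_mul', if_pos (by norm_num), show 5 - 0 - 5 = 0 from rfl, c0]
    unfold gBot; rfl
  · intro o h1 h6
    rw [hc h6, coeff_X_pow_mul', if_neg (by omega)]

/-- **Type `(2,2)`, upper point**: with `netExp q₀ = netExp (q₀+p) = −2`:
`c_{1,q₀+p} = gTop₀/p²`, `c_{0,q₀+p} = gTop₁/p² + 2·gTop₀/p³`, and `c_{o,q₀+p} = 0` for `2 ≤ o < 6`. -/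
theorem pfS_top (he₀ : netExp b q₀ = -2) (he₁ : netExp b (q₀ + p) = -2) :
    pfData b 1 (q₀ + p) = gTop b p q₀ 0 / p ^ 2 ∧
    pfData b 0 (q₀ + p) = gTop b p q₀ 1 / p ^ 2 + 2 * gTop b p q₀ 0 / p ^ 3 ∧
    (∀ o, 2 ≤ o → o < 6 → pfData b o (q₀ + p) = 0) := by
  have hm₀ : mult b q₀ = 4 := by have := mult_eq_netExp b q₀; omega
  have hm₁ : mult b (q₀ + p) = 4 := by have := mult_eq_netExp b (q₀ + p); omega
  have hp0 : (p : ℚ) ≠ 0 := Nat.cast_ne_zero.2 hp.out.ne_zero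
  have hδ : ((q₀ : ℚ) - ((q₀ + p : ℕ) : ℚ)) = -(p : ℚ) := by push_cast; ring
  have hp0' : 0 < p := hp.out.pos
  have hF : Gser b (q₀ + p) * linS (-(p : ℚ)) ^ 2 = Gout b (q₀ + p) q₀ := by
    rw [← hδ]; exact gser_mul_linS_pow b (by omega) (by omega) (by rw [hm₀])
  obtain ⟨c0, c1⟩ := coeff_of_mul_linS_sq (neg_ne_zero.2 hp0) hF
  have hc : ∀ {o : ℕ}, o < 6 → pfData b o (q₀ + p) = coeff (5 - o) (X ^ 4 * Gser b (q₀ + p)) := by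
    intro o ho; rw [pfData_eq_coeff b hb hwin hq₁ ho, hm₁]
  refine ⟨?_, ?_, ?_⟩
  · rw [hc (by norm_num), coeff_X_pow_mul', if_pos (by norm_num), show 5 - 1 - 4 = 0 from rfl, c0]
    unfold gTop; rw [neg_sq]
  · rw [hc (by norm_num), coeff_X_pow_mul', if_pos (by norm_num), show 5 - 0 - 4 = 1 from rfl, c1]
    unfold gTop
    rw [neg_sq, show (-(p : ℚ)) ^ 3 = -((p : ℚ) ^ 3) by ring]
    field_simp
    ring
  · intro o h2 h6
    rw [hc h6, coeff_X_pow_mul', if_neg (by omega)]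

/-- **Type `(2,2)`, lower point**: `c_{1,q₀} = gBot₀/p²`, `c_{0,q₀} = gBot₁/p² − 2·gBot₀/p³`, and `c_{o,q₀} = 0` for
`2 ≤ o < 6`. -/
theorem pfS_bot (he₀ : netExp b q₀ = -2) (he₁ : netExp b (q₀ + p) = -2) :
    pfData b 1 q₀ = gBot b p q₀ 0 / p ^ 2 ∧
    pfData b 0 q₀ = gBot b p q₀ 1 / p ^ 2 - 2 * gBot b p q₀ 0 / p ^ 3 ∧
    (∀ o, 2 ≤ o → o < 6 → pfData b o q₀ = 0) := by
  have hm₀ : mult b q₀ = 4 := by have := mult_eq_netExp b q₀; omega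
  have hm₁ : mult b (q₀ + p) = 4 := by have := mult_eq_netExp b (q₀ + p); omega
  have hp0 : (p : ℚ) ≠ 0 := Nat.cast_ne_zero.2 hp.out.ne_zero
  have hδ : (((q₀ + p : ℕ) : ℚ) - q₀) = (p : ℚ) := by push_cast; ring
  have hp0' : 0 < p := hp.out.pos
  have hF : Gser b q₀ * linS (p : ℚ) ^ 2 = Gout b q₀ (q₀ + p) := by
    rw [← hδ]; exact gser_mul_linS_pow b hq₁ (by omega) (by rw [hm₁])
  obtain ⟨c0, c1⟩ := coeff_of_mul_linS_sq hp0 hF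
  have hc : ∀ {o : ℕ}, o < 6 → pfData b o q₀ = coeff (5 - o) (X ^ 4 * Gser b q₀) := by
    intro o ho; rw [pfData_eq_coeff b hb hwin (by omega) ho, hm₀]
  refine ⟨?_, ?_, ?_⟩
  · rw [hc (by norm_num), coeff_X_pow_mul', if_pos (by norm_num), show 5 - 1 - 4 = 0 from rfl, c0]
    unfold gBot; rfl
  · rw [hc (by norm_num), coeff_X_pow_mul', if_pos (by norm_num), show 5 - 0 - 4 = 1 from rfl, c1]
    unfold gBot; rfl
  · intro o h2 h6
    rw [hc h6, coeff_X_pow_mul', if_neg (by omega)]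

end PF

end Summit.KontsevichZagierPeriods.Zeta5Search.CellA

end
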